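import Summits.BirchSwinnertonDyer.BirchSwinnertonDyer.Theorems.AdditiveBranchIMCTwistRootNumberOddThree
import Summits.BirchSwinnertonDyer.BirchSwinnertonDyer.Theorems.ManinLocalTwoThreeQuadraticTwistAtTwoConductorBarriosRows
import HarnessLib

/-!
# The conductor of `E^{(qℓ)}` prime by prime — curves with odd additive primes of quadratic-twist type and ANY
# reduction at `2` (LEAD g14)

Theorems-side sequel (theorems only; no definition, no named fact, no `sorry`) of `AdditiveBranchIMCTwistRootNumberOddThree`
(p754623, LEAD g13). That engine (`w(E^{(qℓ)}) = w(E)` for a non-split multiplicative Wan prime `q`) assumed NO ADDITIVE REDUCTION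
AT `2`, for one reason only: at an additive place above `2` the tree reads the Atkin–Lehner sign `λ₂` through the local root number,
which it has only at a semistable `2`. The conductor half of the argument needs nothing at `2` beyond «the twist by `D ≡ 1 (mod 4)`
does not move `f₂`» (`ManinLocalTwoThree.conductorExponent_quadraticTwist_eq_of_emod_four_eq_one_two`: `E^{(D)} ≅ E.twistModel k`,
`D = 4k + 1`, Tate's algorithm is blind to an unramified twist). This file is that conductor half, for `E / ℚ` (globally minimal `W`)
whose ODD additive primes are of quadratic-twist type (`htt`) — nothing is assumed at `2` —, `q ≠ 2` multiplicative, `ℓ ≥ 5` good,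
`qℓ ≡ 1 (mod 8)`, `W' = E^{(qℓ)}`:

* `hasReductionAt_quadraticTwist_mul_iff` — away from `q, ℓ` the reduction types of `W'` and `W` agree (at `2`: `qℓ` is a `2`-adic square);
* `conductorExponent_quadraticTwist_mul_eq` — `f_p(W') = f_p(W)` for every prime `p ∉ {q, ℓ}` (at an additive `2`: the mod-`4` lemma);
* `conductorNorm_quadraticTwist_mul_eq` — **`N_{W'} = N_W · q · ℓ²`** (`f_q(W') = 2`: Kodaira `Iₙ*`; `f_ℓ(W') = 2`);
* `conductorExponent_pStar_le`, `conductorExponent_pStar_quadraticTwist_le` — the bound `f_v(X^{(p*)}) ≤ f_v(X)` at the additive `v ≠ p`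
  for `X = W` and `X = W'` and every odd prime `p` (the hypothesis `hle` of `atkinLehnerEigenvalueAt_eq_χ₄_of_twist_of_le`), now INCLUDING
  an additive `v` above `2` (`p* ≡ 1 (mod 4)`).

The root-number identity itself is `AdditiveBranchIMCTwistRootNumberAnyTwo`. BSD is proved for no curve by any of this.
References: [SilvermanATAEC1994] IV.9.4, IV.10–11; [SilvermanAEC2009] VII.5 Prop. 5.1, X.2 Prop. 2.4.
-/

set_option linter.dupNamespace false
set_option autoImplicit false

noncomputable section

open scoped Classical

open Literature.NumberTheory.EllipticCurves Literature.NumberTheory.EllipticCurves.ModularForms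
  IsDedekindDomain IsDedekindDomain.HeightOneSpectrum NumberField Rat.HeightOneSpectrum WeierstrassCurve
  Summit.BirchSwinnertonDyer.BirchSwinnertonDyer.Theorems

namespace Summit.BirchSwinnertonDyer.BirchSwinnertonDyer.Theorems.TwistRootNumberAnyTwo

/-! ### §1 Plumbing at the places of `ℤ`; `f₂` under a twist `≡ 1 (mod 4)` -/

/-- `natGenerator` of the place of `ℤ` under a prime `p` is `p` (the tree's `Rat.natGenerator_primesEquiv_symm`). [folklore] -/
private theorem natGenerator_symm (p : Nat.Primes) : natGenerator ((primesEquiv (R := ℤ)).symm p) = p :=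
  Literature.NumberTheory.EllipticCurves.Rat.natGenerator_primesEquiv_symm p

/-- `d ≡ 1 (mod 8)` implies `d ≡ 1 (mod 4)`. [folklore] -/
theorem emod_four_eq_one_of_emod_eight {d : ℤ} (h8 : d % 8 = 1) : d % 4 = 1 := by omega

/-- `p* = (−1)^{(p−1)/2} p ≡ 1 (mod 4)` for an odd prime `p`. [folklore] -/
theorem pStar_emod_four (p : Nat.Primes) (hp2 : (p : ℕ) ≠ 2) : ((-1 : ℤ) ^ ((p : ℕ) / 2) * p) % 4 = 1 := by
  haveI := Fact.mk p.2
  have h := WeierstrassCurve.four_dvd_pStar_sub_one (p := (p : ℕ)) hp2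
  omega

/-- **`f₂` is not moved by a twist `≡ 1 (mod 4)`**, at the place of `ℤ` under the prime `2` given as a `Nat.Primes`
(`ManinLocalTwoThree.conductorExponent_quadraticTwist_eq_of_emod_four_eq_one_two`). [cite: SilvermanATAEC1994, IV.9.4] -/
theorem conductorExponent_quadraticTwist_eq_of_emod_four_eq_one (X : WeierstrassCurve ℚ) [X.IsElliptic] (r : Nat.Primes)
    (hr2 : (r : ℕ) = 2) {D : ℤ} (hD : D % 4 = 1) :
    (X.quadraticTwist (D : ℚ)).conductorExponent ((primesEquiv (R := ℤ)).symm r) =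
      X.conductorExponent ((primesEquiv (R := ℤ)).symm r) :=
  ManinLocalTwoThree.conductorExponent_quadraticTwist_eq_of_emod_four_eq_one_two X _ (by rw [natGenerator_symm, hr2]) hD

variable (W : WeierstrassCurve ℚ) [W.IsElliptic]

/-! ### §2 Reduction types and twist type along the twist by `qℓ` -/

section Twist

variable {q ℓ : ℕ} [hq : Fact q.Prime] [hℓ : Fact ℓ.Prime]

/-- A prime `p ∉ {q, ℓ}` does not divide `qℓ`. [folklore] -/
theorem not_natGenerator_dvd_mul (p : Nat.Primes) (hpq : p ≠ ⟨q, hq.out⟩) (hpℓ : p ≠ ⟨ℓ, hℓ.out⟩) :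
    ¬ ((natGenerator ((primesEquiv (R := ℤ)).symm p) : ℕ) : ℤ) ∣ (q : ℤ) * ℓ := by
  intro h
  rw [natGenerator_symm] at h
  rcases (Nat.prime_iff_prime_int.mp p.2).dvd_or_dvd h with h | h
  · exact hpq (Subtype.ext ((Nat.prime_dvd_prime_iff_eq p.2 hq.out).mp (Int.natCast_dvd_natCast.mp h)))
  · exact hpℓ (Subtype.ext ((Nat.prime_dvd_prime_iff_eq p.2 hℓ.out).mp (Int.natCast_dvd_natCast.mp h)))

/-- `q² ∤ qℓ` for distinct primes `q, ℓ`. [folklore] -/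
theorem not_sq_dvd_mul (hqℓ : q ≠ ℓ) : ¬ (q : ℤ) ^ 2 ∣ (q : ℤ) * ℓ := by
  rintro ⟨w, hw⟩
  have hq0 : (q : ℤ) ≠ 0 := by exact_mod_cast hq.out.ne_zero
  have : (q : ℤ) ∣ ℓ := ⟨w, mul_left_cancel₀ hq0 (by rw [hw]; ring)⟩
  exact hqℓ ((Nat.prime_dvd_prime_iff_eq hq.out hℓ.out).mp (Int.natCast_dvd_natCast.mp this))

/-- **Away from `q, ℓ` the reduction types of `E^{(qℓ)}` and `E` agree** (`qℓ ≡ 1 (mod 8)`): at `2` the twist is by a `2`-adic square,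
at an odd `p ∉ {q, ℓ}` by a `p`-adic unit. [cite: SilvermanAEC2009, VII.5 Prop. 5.1] -/
theorem hasReductionAt_quadraticTwist_mul_iff (h8 : ((q : ℤ) * ℓ) % 8 = 1) (p : Nat.Primes) (hpq : p ≠ ⟨q, hq.out⟩)
    (hpℓ : p ≠ ⟨ℓ, hℓ.out⟩) :
    ((W.quadraticTwist (((q : ℤ) * ℓ : ℤ) : ℚ)).HasGoodReductionAt ((primesEquiv (R := ℤ)).symm p) ↔
        W.HasGoodReductionAt ((primesEquiv (R := ℤ)).symm p)) ∧
      ((W.quadraticTwist (((q : ℤ) * ℓ : ℤ) : ℚ)).HasMultiplicativeReductionAt ((primesEquiv (R := ℤ)).symm p) ↔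
        W.HasMultiplicativeReductionAt ((primesEquiv (R := ℤ)).symm p)) ∧
      ((W.quadraticTwist (((q : ℤ) * ℓ : ℤ) : ℚ)).HasAdditiveReductionAt ((primesEquiv (R := ℤ)).symm p) ↔
        W.HasAdditiveReductionAt ((primesEquiv (R := ℤ)).symm p)) := by
  have hd0 : ((q : ℤ) * ℓ : ℤ) ≠ 0 := mul_ne_zero (by exact_mod_cast hq.out.ne_zero) (by exact_mod_cast hℓ.out.ne_zero)
  by_cases hp2 : (p : ℕ) = 2
  · haveI := Fact.mk p.2
    have hsq : IsSquare ((((q : ℤ) * ℓ : ℤ)) : ℚ_[p]) := isSquare_padic_of_emod_eight_eq_one hp2 h8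
    exact ⟨W.hasGoodReductionAt_quadraticTwist_iff_of_isSquare p hd0 hsq,
      W.hasMultiplicativeReductionAt_quadraticTwist_iff_of_isSquare p hd0 hsq,
      W.hasAdditiveReductionAt_quadraticTwist_iff_of_isSquare p hd0 hsq⟩
  · exact W.hasReductionAt_quadraticTwist_iff_of_not_dvd _ (by rw [natGenerator_symm]; exact hp2)
      (not_natGenerator_dvd_mul p hpq hpℓ)

end Twist

/-- **Quadratic-twist type at an odd prime `R` is transported along a twist by a parameter prime to `R`.**
[cite: SilvermanAEC2009, VII.5 Prop. 5.1] -/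
theorem twistType_quadraticTwist_of_not_dvd
    (htt : ∀ p : Nat.Primes, (p : ℕ) ≠ 2 → W.HasAdditiveReductionAt ((primesEquiv (R := ℤ)).symm p) →
      ¬ (W.quadraticTwist (((-1 : ℤ) ^ ((p : ℕ) / 2) * p : ℤ) : ℚ)).HasAdditiveReductionAt
        ((primesEquiv (R := ℤ)).symm p))
    (u : ℤ) (R : Nat.Primes) (hR2 : (R : ℕ) ≠ 2) (hRu : ¬ ((natGenerator ((primesEquiv (R := ℤ)).symm R) : ℕ) : ℤ) ∣ u)
    (ha : W.HasAdditiveReductionAt ((primesEquiv (R := ℤ)).symm R)) :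
    ¬ ((W.quadraticTwist (u : ℚ)).quadraticTwist (((-1 : ℤ) ^ ((R : ℕ) / 2) * R : ℤ) : ℚ)).HasAdditiveReductionAt
      ((primesEquiv (R := ℤ)).symm R) := by
  have hrs0 : (((-1 : ℤ) ^ ((R : ℕ) / 2) * R : ℤ) : ℚ) ≠ 0 := by
    have : (-1 : ℤ) ^ ((R : ℕ) / 2) * R ≠ 0 := mul_ne_zero (pow_ne_zero _ (by norm_num)) (by exact_mod_cast R.2.ne_zero)
    exact_mod_cast this
  haveI := W.isElliptic_quadraticTwist hrs0
  have key : (W.quadraticTwist (u : ℚ)).quadraticTwist (((-1 : ℤ) ^ ((R : ℕ) / 2) * R : ℤ) : ℚ) =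
      (W.quadraticTwist (((-1 : ℤ) ^ ((R : ℕ) / 2) * R : ℤ) : ℚ)).quadraticTwist (u : ℚ) := by
    rw [quadraticTwist_quadraticTwist, quadraticTwist_quadraticTwist, mul_comm]
  rw [key, ((W.quadraticTwist _).hasReductionAt_quadraticTwist_iff_of_not_dvd _
    (by rw [natGenerator_symm]; exact hR2) hRu).2.2]
  exact htt R hR2 ha

/-! ### §3 Conductor exponents, the level of `E^{(qℓ)}`, and the `hle` bounds — odd additive primes of twist type, any `2` -/

section TwistType

variable (htt : ∀ p : Nat.Primes, (p : ℕ) ≠ 2 → W.HasAdditiveReductionAt ((primesEquiv (R := ℤ)).symm p) →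
    ¬ (W.quadraticTwist (((-1 : ℤ) ^ ((p : ℕ) / 2) * p : ℤ) : ℚ)).HasAdditiveReductionAt ((primesEquiv (R := ℤ)).symm p))

include htt

/-- **The bound `f_v(E^{(p*)}) ≤ f_v(E)` at the additive places `v ≠ p` of `E`, for every odd prime `p`** (hypothesis `hle` of
`atkinLehnerEigenvalueAt_eq_χ₄_of_twist_of_le`): at an additive `2` equality (`p* ≡ 1 (mod 4)`), at an odd additive prime both are `2`.
[cite: SilvermanATAEC1994, IV.9.4 and IV.10.2] -/
theorem conductorExponent_pStar_le (p : Nat.Primes) (hp2 : (p : ℕ) ≠ 2) :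
    ∀ v : HeightOneSpectrum ℤ, natGenerator v ≠ p → W.HasAdditiveReductionAt v →
      (W.quadraticTwist (((-1 : ℤ) ^ ((p : ℕ) / 2) * p : ℤ) : ℚ)).conductorExponent v ≤ W.conductorExponent v := by
  intro v hvp hadd
  obtain ⟨r, rfl⟩ := (primesEquiv (R := ℤ)).symm.surjective v
  rw [natGenerator_symm] at hvp
  have hrp : r ≠ p := fun h ↦ hvp (congrArg Subtype.val h)
  by_cases hr2 : (r : ℕ) = 2
  · exact (conductorExponent_quadraticTwist_eq_of_emod_four_eq_one W r hr2 (pStar_emod_four p hp2)).le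
  have hps0Z : ((-1 : ℤ) ^ ((p : ℕ) / 2) * p : ℤ) ≠ 0 := mul_ne_zero (pow_ne_zero _ (by norm_num)) (by exact_mod_cast p.2.ne_zero)
  haveI := W.isElliptic_quadraticTwist (show (((-1 : ℤ) ^ ((p : ℕ) / 2) * p : ℤ) : ℚ) ≠ 0 by exact_mod_cast hps0Z)
  haveI := Fact.mk p.2
  have hadd2 : (W.quadraticTwist (((-1 : ℤ) ^ ((p : ℕ) / 2) * p : ℤ) : ℚ)).HasAdditiveReductionAt ((primesEquiv (R := ℤ)).symm r) :=
    ((W.hasReductionAt_quadraticTwist_pStar_iff (p := (p : ℕ)) hp2 _ (by rw [natGenerator_symm]; exact hvp)).2.2).mpr hadd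
  have hrps : ¬ ((natGenerator ((primesEquiv (R := ℤ)).symm r) : ℕ) : ℤ) ∣ ((-1 : ℤ) ^ ((p : ℕ) / 2) * p) := by
    intro h
    rw [natGenerator_symm] at h
    exact hrp (Subtype.ext ((Nat.prime_dvd_prime_iff_eq r.2 p.2).mp
      (Int.natCast_dvd_natCast.mp (((isUnit_neg_one (α := ℤ)).pow _).dvd_mul_left.mp h))))
  rw [TwistTypeConductor.conductorExponent_eq_two_of_twistType_odd _ r hr2 hadd2
      (fun _ ↦ twistType_quadraticTwist_of_not_dvd W htt _ r hr2 hrps hadd),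
    TwistTypeConductor.conductorExponent_eq_two_of_twistType_odd W r hr2 hadd (fun _ ↦ htt r hr2 hadd)]

variable {q ℓ : ℕ} [hq : Fact q.Prime] [hℓ : Fact ℓ.Prime]

/-- **`f_p(E^{(qℓ)}) = f_p(E)` at every prime `p ∉ {q, ℓ}`** — INCLUDING an additive `2`: good / multiplicative types agree
(`hasReductionAt_quadraticTwist_mul_iff`); at an odd additive prime both exponents are `2` (quadratic-twist type, transported to the twist);
at an additive `2` the twist `qℓ ≡ 1 (mod 4)` does not move `f₂`. [cite: SilvermanATAEC1994, IV.9.4 and IV.10.2] -/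
theorem conductorExponent_quadraticTwist_mul_eq (h8 : ((q : ℤ) * ℓ) % 8 = 1) (p : Nat.Primes) (hpq : p ≠ ⟨q, hq.out⟩)
    (hpℓ : p ≠ ⟨ℓ, hℓ.out⟩) :
    haveI := W.isElliptic_quadraticTwist (show (((q : ℤ) * ℓ : ℤ) : ℚ) ≠ 0 by
      exact_mod_cast mul_ne_zero (by exact_mod_cast hq.out.ne_zero) (by exact_mod_cast hℓ.out.ne_zero))
    (W.quadraticTwist (((q : ℤ) * ℓ : ℤ) : ℚ)).conductorExponent ((primesEquiv (R := ℤ)).symm p) =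
      W.conductorExponent ((primesEquiv (R := ℤ)).symm p) := by
  have hd0 : ((q : ℤ) * ℓ : ℤ) ≠ 0 := mul_ne_zero (by exact_mod_cast hq.out.ne_zero) (by exact_mod_cast hℓ.out.ne_zero)
  haveI := W.isElliptic_quadraticTwist (show (((q : ℤ) * ℓ : ℤ) : ℚ) ≠ 0 by exact_mod_cast hd0)
  set W' := W.quadraticTwist (((q : ℤ) * ℓ : ℤ) : ℚ) with hW'
  obtain ⟨hg, hm, ha⟩ := hasReductionAt_quadraticTwist_mul_iff W h8 p hpq hpℓ
  rcases hasGoodReductionAt_or_hasMultiplicativeReductionAt_or_hasAdditiveReductionAt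
    ((primesEquiv (R := ℤ)).symm p) W with h | h | h
  · rw [(conductorExponent_eq_zero_iff_holds _ W').mpr (hg.mpr h), (conductorExponent_eq_zero_iff_holds _ W).mpr h]
  · rw [(conductorExponent_eq_one_iff_holds _ W').mpr (hm.mpr h), (conductorExponent_eq_one_iff_holds _ W).mpr h]
  · by_cases hp2 : (p : ℕ) = 2
    · exact conductorExponent_quadraticTwist_eq_of_emod_four_eq_one W p hp2 (emod_four_eq_one_of_emod_eight h8)
    · rw [TwistTypeConductor.conductorExponent_eq_two_of_twistType_odd W' p hp2 (ha.mpr h)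
          (fun _ ↦ twistType_quadraticTwist_of_not_dvd W htt _ p hp2 (not_natGenerator_dvd_mul p hpq hpℓ) h),
        TwistTypeConductor.conductorExponent_eq_two_of_twistType_odd W p hp2 h (fun _ ↦ htt p hp2 h)]

variable [W.IsGloballyMinimal]

/-- **`N_{E^{(qℓ)}} = N_E · q · ℓ²`**: `f_q(E^{(qℓ)}) = 2` (Kodaira `Iₙ*` at the multiplicative `q`), `f_q(E) = 1`; `f_ℓ(E^{(qℓ)}) = 2`
(`ℓ ≥ 5` additive), `f_ℓ(E) = 0`; equal exponents elsewhere (`conductorExponent_quadraticTwist_mul_eq`). No hypothesis at `2`.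
[cite: SilvermanATAEC1994, IV.10.2 and IV.11.1] -/
theorem conductorNorm_quadraticTwist_mul_eq (hq2 : q ≠ 2) (hℓ5 : 5 ≤ ℓ) (hqℓ : q ≠ ℓ) (hqm : W.HasMultiplicativeReductionAtPrime q)
    (hℓg : W.HasGoodReductionAtPrime ℓ) (h8 : ((q : ℤ) * ℓ) % 8 = 1) :
    (W.quadraticTwist (((q : ℤ) * ℓ : ℤ) : ℚ)).conductorNorm ℤ = W.conductorNorm ℤ * q * ℓ ^ 2 := by
  have hℓ2 : ℓ ≠ 2 := by omega
  have hd0 : ((q : ℤ) * ℓ : ℤ) ≠ 0 := mul_ne_zero (by exact_mod_cast hq.out.ne_zero) (by exact_mod_cast hℓ.out.ne_zero)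
  haveI := W.isElliptic_quadraticTwist (show (((q : ℤ) * ℓ : ℤ) : ℚ) ≠ 0 by exact_mod_cast hd0)
  set W' := W.quadraticTwist (((q : ℤ) * ℓ : ℤ) : ℚ) with hW'
  set Pq : Nat.Primes := ⟨q, hq.out⟩
  set Pℓ : Nat.Primes := ⟨ℓ, hℓ.out⟩
  set N := W.conductorNorm ℤ with hN
  have hN0 : N ≠ 0 := (W.conductorNorm_pos_holds).ne'
  have hN'0 : W'.conductorNorm ℤ ≠ 0 := (W'.conductorNorm_pos_holds).ne'
  have hfq' : W'.conductorExponent ((primesEquiv (R := ℤ)).symm Pq) = 2 :=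
    TwistRootNumberOdd.conductorExponent_quadraticTwist_eq_two_of_hasMultiplicativeReductionAtPrime W hq2 hqm hd0
      (dvd_mul_right _ _) (not_sq_dvd_mul hqℓ)
  have hfq : W.conductorExponent ((primesEquiv (R := ℤ)).symm Pq) = 1 :=
    (conductorExponent_eq_one_iff_holds _ W).mpr
      ((W.hasMultiplicativeReductionAtPrime_iff_hasMultiplicativeReductionAt_holds Pq).mp hqm)
  have hfℓ' : W'.conductorExponent ((primesEquiv (R := ℤ)).symm Pℓ) = 2 :=
    Literature.NumberTheory.EllipticCurves.conductorExponent_eq_two_of_five_le_holds W' _ (by rw [natGenerator_symm]; exact hℓ5)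
      (W.hasAdditiveReductionAt_quadraticTwist_mul_of_hasGoodReductionAtPrime hℓ2 hqℓ hℓg)
  have hfℓ : W.conductorExponent ((primesEquiv (R := ℤ)).symm Pℓ) = 0 :=
    (conductorExponent_eq_zero_iff_holds _ W).mpr ((W.hasGoodReductionAtPrime_iff_hasGoodReductionAt_holds Pℓ).mp hℓg)
  refine Nat.eq_of_factorization_eq hN'0 (mul_ne_zero (mul_ne_zero hN0 hq.out.ne_zero) (pow_ne_zero _ hℓ.out.ne_zero))
    fun r ↦ ?_
  by_cases hr : r.Prime
  swap
  · rw [Nat.factorization_eq_zero_of_not_prime _ hr, Nat.factorization_eq_zero_of_not_prime _ hr]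
  rw [Nat.factorization_mul (mul_ne_zero hN0 hq.out.ne_zero) (pow_ne_zero _ hℓ.out.ne_zero),
    Nat.factorization_mul hN0 hq.out.ne_zero, Nat.factorization_pow]
  simp only [Finsupp.add_apply, Finsupp.smul_apply, hq.out.factorization, hℓ.out.factorization, smul_eq_mul]
  set R : Nat.Primes := ⟨r, hr⟩
  rw [show (W'.conductorNorm ℤ).factorization r = (W'.conductorNorm ℤ).factorization R from rfl,
    show N.factorization r = N.factorization R from rfl, factorization_conductorNorm_primesEquiv_symm W' R,
    factorization_conductorNorm_primesEquiv_symm W R]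
  by_cases hrq : r = q
  · have hR : R = Pq := Subtype.ext hrq
    rw [hR, hfq', hfq]
    simp [hrq, hqℓ]
  by_cases hrℓ : r = ℓ
  · have hR : R = Pℓ := Subtype.ext hrℓ
    rw [hR, hfℓ', hfℓ]
    simp [hrℓ, Ne.symm hqℓ]
  rw [conductorExponent_quadraticTwist_mul_eq W htt h8 R (fun h ↦ hrq (congrArg Subtype.val h))
      (fun h ↦ hrℓ (congrArg Subtype.val h))]
  simp [hrq, hrℓ]

/-- **The `hle` bound for the twist `W' = E^{(qℓ)}`**: at `q` both exponents are `2` (Kodaira `Iₙ*` for `qℓ` and for `qℓ·p*`), at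
`ℓ ≥ 5` both are `2`, at an additive `2` equality (`p* ≡ 1 (mod 4)`), at the other odd additive primes both are `2` (twist type
transported). [cite: SilvermanATAEC1994, IV.9.4 and IV.10.2] -/
theorem conductorExponent_pStar_quadraticTwist_le (hq2 : q ≠ 2) (hℓ5 : 5 ≤ ℓ) (hqℓ : q ≠ ℓ)
    (hqm : W.HasMultiplicativeReductionAtPrime q) (h8 : ((q : ℤ) * ℓ) % 8 = 1) (p : Nat.Primes) (hp2 : (p : ℕ) ≠ 2) :
    haveI := W.isElliptic_quadraticTwist (show (((q : ℤ) * ℓ : ℤ) : ℚ) ≠ 0 by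
      exact_mod_cast mul_ne_zero (by exact_mod_cast hq.out.ne_zero) (by exact_mod_cast hℓ.out.ne_zero))
    ∀ v : HeightOneSpectrum ℤ, natGenerator v ≠ p → (W.quadraticTwist (((q : ℤ) * ℓ : ℤ) : ℚ)).HasAdditiveReductionAt v →
      ((W.quadraticTwist (((q : ℤ) * ℓ : ℤ) : ℚ)).quadraticTwist
          (((-1 : ℤ) ^ ((p : ℕ) / 2) * p : ℤ) : ℚ)).conductorExponent v ≤
        (W.quadraticTwist (((q : ℤ) * ℓ : ℤ) : ℚ)).conductorExponent v := by
  set d : ℤ := (q : ℤ) * ℓ with hd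
  have hd0 : d ≠ 0 := mul_ne_zero (by exact_mod_cast hq.out.ne_zero) (by exact_mod_cast hℓ.out.ne_zero)
  haveI := W.isElliptic_quadraticTwist (show (d : ℚ) ≠ 0 by exact_mod_cast hd0)
  set W' := W.quadraticTwist (d : ℚ) with hW'
  set Pq : Nat.Primes := ⟨q, hq.out⟩
  set Pℓ : Nat.Primes := ⟨ℓ, hℓ.out⟩
  intro v hvp hadd
  obtain ⟨r, rfl⟩ := (primesEquiv (R := ℤ)).symm.surjective v
  rw [natGenerator_symm] at hvp
  have hrp : r ≠ p := fun h ↦ hvp (congrArg Subtype.val h)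
  have hps0Z : ((-1 : ℤ) ^ ((p : ℕ) / 2) * p : ℤ) ≠ 0 := mul_ne_zero (pow_ne_zero _ (by norm_num)) (by exact_mod_cast p.2.ne_zero)
  haveI := W'.isElliptic_quadraticTwist (show (((-1 : ℤ) ^ ((p : ℕ) / 2) * p : ℤ) : ℚ) ≠ 0 by exact_mod_cast hps0Z)
  haveI := Fact.mk p.2
  by_cases hr2 : (r : ℕ) = 2
  · exact (conductorExponent_quadraticTwist_eq_of_emod_four_eq_one W' r hr2 (pStar_emod_four p hp2)).le
  have hD0' : d * ((-1 : ℤ) ^ ((p : ℕ) / 2) * p) ≠ 0 := mul_ne_zero hd0 hps0Z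
  have keyD : W'.quadraticTwist (((-1 : ℤ) ^ ((p : ℕ) / 2) * p : ℤ) : ℚ) =
      W.quadraticTwist (((d * ((-1 : ℤ) ^ ((p : ℕ) / 2) * p)) : ℤ) : ℚ) := by
    rw [hW', quadraticTwist_quadraticTwist]; push_cast; ring_nf
  by_cases hrq : r = Pq
  · -- at `q`: both are `2` (Kodaira `Iₙ*`)
    have hpq : (q : ℕ) ≠ (p : ℕ) := fun h ↦ hvp (by rw [hrq, ← h])
    have h1 : (q : ℤ) ∣ d * ((-1 : ℤ) ^ ((p : ℕ) / 2) * p) := by rw [hd]; exact (dvd_mul_right _ _).mul_right _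
    have h2 : ¬ (q : ℤ) ^ 2 ∣ d * ((-1 : ℤ) ^ ((p : ℕ) / 2) * p) := by
      rw [hd]
      intro h
      have hqZ : Prime (q : ℤ) := Nat.prime_iff_prime_int.mp hq.out
      have h' : (q : ℤ) * q ∣ q * (ℓ * ((-1 : ℤ) ^ ((p : ℕ) / 2) * p)) := by rw [← sq, ← mul_assoc]; exact h
      have h'' : (q : ℤ) ∣ ℓ * ((-1 : ℤ) ^ ((p : ℕ) / 2) * p) :=
        (mul_dvd_mul_iff_left (by exact_mod_cast hq.out.ne_zero)).mp h'
      rcases hqZ.dvd_or_dvd h'' with h3 | h3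
      · exact hqℓ ((Nat.prime_dvd_prime_iff_eq hq.out hℓ.out).mp (Int.natCast_dvd_natCast.mp h3))
      · have h4 : (q : ℤ) ∣ (p : ℤ) := ((isUnit_neg_one (α := ℤ)).pow _).dvd_mul_left.mp h3
        exact hpq ((Nat.prime_dvd_prime_iff_eq hq.out p.2).mp (Int.natCast_dvd_natCast.mp h4))
    have hfq' : W'.conductorExponent ((primesEquiv (R := ℤ)).symm Pq) = 2 :=
      TwistRootNumberOdd.conductorExponent_quadraticTwist_eq_two_of_hasMultiplicativeReductionAtPrime W hq2 hqm hd0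
        (by rw [hd]; exact dvd_mul_right _ _) (by rw [hd]; exact not_sq_dvd_mul hqℓ)
    rw [hrq, hfq', keyD]
    exact (TwistRootNumberOdd.conductorExponent_quadraticTwist_eq_two_of_hasMultiplicativeReductionAtPrime W hq2 hqm hD0' h1 h2).le
  -- elsewhere: `ℓ ≥ 5`, or an odd additive prime of `W` of twist type; both are `2`
  have hadd2 : (W'.quadraticTwist (((-1 : ℤ) ^ ((p : ℕ) / 2) * p : ℤ) : ℚ)).HasAdditiveReductionAt
      ((primesEquiv (R := ℤ)).symm r) :=
    ((W'.hasReductionAt_quadraticTwist_pStar_iff (p := (p : ℕ)) hp2 _ (by rw [natGenerator_symm]; exact hvp)).2.2).mpr hadd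
  by_cases hrℓ : r = Pℓ
  · have hr5 : 5 ≤ (r : ℕ) := by rw [hrℓ]; exact hℓ5
    rw [Literature.NumberTheory.EllipticCurves.conductorExponent_eq_two_of_five_le_holds _ _
        (by rw [natGenerator_symm]; exact hr5) hadd2,
      Literature.NumberTheory.EllipticCurves.conductorExponent_eq_two_of_five_le_holds W' _
        (by rw [natGenerator_symm]; exact hr5) hadd]
  have haddW : W.HasAdditiveReductionAt ((primesEquiv (R := ℤ)).symm r) :=
    (hasReductionAt_quadraticTwist_mul_iff W h8 r hrq hrℓ).2.2.mp hadd
  have hru : ¬ ((natGenerator ((primesEquiv (R := ℤ)).symm r) : ℕ) : ℤ) ∣ d * ((-1 : ℤ) ^ ((p : ℕ) / 2) * p) := by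
    intro h
    rcases (Nat.prime_iff_prime_int.mp (prime_natGenerator _)).dvd_or_dvd h with h | h
    · exact not_natGenerator_dvd_mul r hrq hrℓ h
    · rw [natGenerator_symm] at h
      exact hrp (Subtype.ext ((Nat.prime_dvd_prime_iff_eq r.2 p.2).mp
        (Int.natCast_dvd_natCast.mp (((isUnit_neg_one (α := ℤ)).pow _).dvd_mul_left.mp h))))
  have htw1 : ¬ ((W'.quadraticTwist (((-1 : ℤ) ^ ((p : ℕ) / 2) * p : ℤ) : ℚ)).quadraticTwist
      (((-1 : ℤ) ^ ((r : ℕ) / 2) * r : ℤ) : ℚ)).HasAdditiveReductionAt ((primesEquiv (R := ℤ)).symm r) := by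
    rw [keyD]; exact twistType_quadraticTwist_of_not_dvd W htt _ r hr2 hru haddW
  have htw2 : ¬ (W'.quadraticTwist (((-1 : ℤ) ^ ((r : ℕ) / 2) * r : ℤ) : ℚ)).HasAdditiveReductionAt
      ((primesEquiv (R := ℤ)).symm r) := by
    rw [hW', hd]; exact twistType_quadraticTwist_of_not_dvd W htt _ r hr2 (not_natGenerator_dvd_mul r hrq hrℓ) haddW
  rw [TwistTypeConductor.conductorExponent_eq_two_of_twistType_odd _ r hr2 hadd2 (fun _ ↦ htw1),
    TwistTypeConductor.conductorExponent_eq_two_of_twistType_odd W' r hr2 hadd (fun _ ↦ htw2)]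

end TwistType

end Summit.BirchSwinnertonDyer.BirchSwinnertonDyer.Theorems.TwistRootNumberAnyTwo

end
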